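import Summits.CriticalPhenomena.PercolationContinuityZ3.Theorems.PercNearOneGluingNoHeavyLowerTailSahiGridPatternCoLiftPrelim

/-!
# `NoHeavyLowerTail` (crux stmt-CriticalPhenomena-4575), Sahi programme: **THE QUANTITATIVE CO-TOP LIFT `(D,⊤,⊤)`, EVERY DIMENSION** —
# `sStarD ⊤ B₁ C₁ + sStarD ⊤ B₂ C₂ ≤ sStarD A B C`

Support file (lineage `prim-master-conj`, generation 48; `--supports stmt-CriticalPhenomena-4575`).  Pure proofs, no definitions,
no `sorry`, standard axioms.  Vocabulary of `…SahiGridPattern{TwoLayerTop,Orthant,CoLiftPrelim}`; companion of the co-lift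
`…SahiGridPatternCoTop` (seat `prim-sahi-p1`, gen 9), which proves `0 ≤ sStarD A B C` for the same pattern.

THE MATHEMATICS.  Slice an up-set `A ⊆ [3]^{n+1}` along the last axis, `A_l = {q : snoc q l ∈ A}`; `B_l, C_l` are the slices of
the arbitrary up-sets `B, C`, and `sStarD ⊤ X Y = 2^n |X ∩ Y| − N(X, Y)` is the coefficientwise Harris form (the section functional
of the whole cube).  THEOREM (`sum_hs_le_of_coTop`, every `n`): if `A` contains the two upper levels (`A₁ = A₂ = ⊤`, bottom slice
`A₀ = D` ARBITRARY), then
    `sStarD ⊤ B₁ C₁ + sStarD ⊤ B₂ C₂ ≤ sStarD A B C`.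
Since `A₁ = A₂ = ⊤`, the two left-hand terms are the section functionals `κ_n(A₁,B₁,C₁)` and `κ_n(A₂,B₂,C₂)`: this is the `(D,⊤,⊤)`
case of the 'section-lift' inequality `κ_{n+1}(a,b,c) ≥ κ_n(a₁,b₁,c₁) + κ_n(a₂,b₂,c₂)` of the lineage memo
`run/shared/lean/prim/prim-l12/FROM-prim-master-conj-g48-SECTION-LIFTS.md` (numerically valid for all triples through `d = 7`, tight from
`d = 5`, not cellwise-certifiable in general; certifiable here).  For `D = ⊤` it is the supermodularity step of prim-ineq-gen-4's HARRIS-TOP.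
PROOF.  Exact integer certificate (kit j283176, config ct2): the 27-block expansion of `…CoTop`, coefficientwise Harris for the four pairs
`(D∩B₀, C₁), (D∩B₀, C₂), (D∩C₀, B₁), (D∩C₀, B₂)`, the two fibre-Kleitman slacks with free first argument `⊤∖D` and pairs `(B₁,C₂)`,
`(B₂,C₁)`, and eight sums of products of nonnegative increments; `linarith` assembles them. [this work]
-/

namespace Summit.CriticalPhenomena.PercolationContinuityZ3.Theorems.SahiGridPattern

open Finset SahiGrid3
open scoped BigOperators

variable {n : ℕ}

set_option maxHeartbeats 1000000 in
/-- **QUANTITATIVE CO-TOP LIFT** (every `n`): if the up-set `A ⊆ [3]^{n+1}` contains every point of the two upper levels of the last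
axis (pattern `(D,⊤,⊤)`, `D` arbitrary), then for ARBITRARY up-sets `B, C` with slices `B_l, C_l`:
`sStarD ⊤ B₁ C₁ + sStarD ⊤ B₂ C₂ ≤ sStarD A B C`.  (Exact LP certificate, kit j283176/ct2.) [this work] -/
theorem sum_hs_le_of_coTop (A B C : Finset (Pd (n + 1)))
    (hA : IsUpperSet (A : Set (Pd (n + 1)))) (hB : IsUpperSet (B : Set (Pd (n + 1)))) (hC : IsUpperSet (C : Set (Pd (n + 1))))
    (hA1 : ∀ q : Pd n, (Fin.snoc q 1 : Pd (n + 1)) ∈ A) :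
    sStarD (univ : Finset (Pd n)) (univ.filter fun q : Pd n => (Fin.snoc q 1 : Pd (n + 1)) ∈ B) (univ.filter fun q : Pd n => (Fin.snoc q 1 : Pd (n + 1)) ∈ C)
      + sStarD (univ : Finset (Pd n)) (univ.filter fun q : Pd n => (Fin.snoc q 2 : Pd (n + 1)) ∈ B) (univ.filter fun q : Pd n => (Fin.snoc q 2 : Pd (n + 1)) ∈ C)
      ≤ sStarD A B C := by
  set D : Finset (Pd n) := (univ.filter fun q : Pd n => (Fin.snoc q 0 : Pd (n + 1)) ∈ A) with hDdef
  set P0 : Finset (Pd n) := (univ.filter fun q : Pd n => (Fin.snoc q 0 : Pd (n + 1)) ∈ B) with hP0def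
  set P1 : Finset (Pd n) := (univ.filter fun q : Pd n => (Fin.snoc q 1 : Pd (n + 1)) ∈ B) with hP1def
  set P2 : Finset (Pd n) := (univ.filter fun q : Pd n => (Fin.snoc q 2 : Pd (n + 1)) ∈ B) with hP2def
  set Q0 : Finset (Pd n) := (univ.filter fun q : Pd n => (Fin.snoc q 0 : Pd (n + 1)) ∈ C) with hQ0def
  set Q1 : Finset (Pd n) := (univ.filter fun q : Pd n => (Fin.snoc q 1 : Pd (n + 1)) ∈ C) with hQ1def
  set Q2 : Finset (Pd n) := (univ.filter fun q : Pd n => (Fin.snoc q 2 : Pd (n + 1)) ∈ C) with hQ2def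
  have iA0 : ∀ p, ind A (Fin.snoc p 0) = ind D p := fun p => by rw [hDdef, ind_filter_snoc]
  have iA1 : ∀ p, ind A (Fin.snoc p 1) = ind (univ : Finset (Pd n)) p := fun p => by
    unfold ind; rw [if_pos (hA1 p), if_pos (Finset.mem_univ _)]
  have iA2 : ∀ p, ind A (Fin.snoc p 2) = ind (univ : Finset (Pd n)) p := fun p => by
    unfold ind; rw [if_pos (Finset.mem_coe.1 (hA (snoc_le_snoc_of_le p (by decide : (1:Fin 3) ≤ 2)) (Finset.mem_coe.2 (hA1 p)))), if_pos (Finset.mem_univ _)]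
  have iP0 : ∀ p, ind B (Fin.snoc p 0) = ind P0 p := fun p => by rw [hP0def, ind_filter_snoc]
  have iP1 : ∀ p, ind B (Fin.snoc p 1) = ind P1 p := fun p => by rw [hP1def, ind_filter_snoc]
  have iP2 : ∀ p, ind B (Fin.snoc p 2) = ind P2 p := fun p => by rw [hP2def, ind_filter_snoc]
  have iQ0 : ∀ p, ind C (Fin.snoc p 0) = ind Q0 p := fun p => by rw [hQ0def, ind_filter_snoc]
  have iQ1 : ∀ p, ind C (Fin.snoc p 1) = ind Q1 p := fun p => by rw [hQ1def, ind_filter_snoc]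
  have iQ2 : ∀ p, ind C (Fin.snoc p 2) = ind Q2 p := fun p => by rw [hQ2def, ind_filter_snoc]
  have hDup : IsUpperSet (D : Set (Pd n)) := by rw [hDdef]; exact isUpperSet_filter_snoc hA 0
  have hUup : IsUpperSet ((univ : Finset (Pd n)) : Set (Pd n)) := by rw [Finset.coe_univ]; exact isUpperSet_univ
  have hP0up : IsUpperSet (P0 : Set (Pd n)) := by rw [hP0def]; exact isUpperSet_filter_snoc hB 0
  have hP1up : IsUpperSet (P1 : Set (Pd n)) := by rw [hP1def]; exact isUpperSet_filter_snoc hB 1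
  have hP2up : IsUpperSet (P2 : Set (Pd n)) := by rw [hP2def]; exact isUpperSet_filter_snoc hB 2
  have hQ0up : IsUpperSet (Q0 : Set (Pd n)) := by rw [hQ0def]; exact isUpperSet_filter_snoc hC 0
  have hQ1up : IsUpperSet (Q1 : Set (Pd n)) := by rw [hQ1def]; exact isUpperSet_filter_snoc hC 1
  have hQ2up : IsUpperSet (Q2 : Set (Pd n)) := by rw [hQ2def]; exact isUpperSet_filter_snoc hC 2
  have nP01 : ∀ p, ind P0 p ≤ ind P1 p := fun p => by rw [← iP0, ← iP1]; exact ind_snoc_mono hB p (by decide)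
  have sP01 : P0 ⊆ P1 := subset_of_ind_le nP01
  have nP12 : ∀ p, ind P1 p ≤ ind P2 p := fun p => by rw [← iP1, ← iP2]; exact ind_snoc_mono hB p (by decide)
  have sP12 : P1 ⊆ P2 := subset_of_ind_le nP12
  have nP02 : ∀ p, ind P0 p ≤ ind P2 p := fun p => by rw [← iP0, ← iP2]; exact ind_snoc_mono hB p (by decide)
  have sP02 : P0 ⊆ P2 := subset_of_ind_le nP02
  have nQ01 : ∀ p, ind Q0 p ≤ ind Q1 p := fun p => by rw [← iQ0, ← iQ1]; exact ind_snoc_mono hC p (by decide)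
  have sQ01 : Q0 ⊆ Q1 := subset_of_ind_le nQ01
  have nQ12 : ∀ p, ind Q1 p ≤ ind Q2 p := fun p => by rw [← iQ1, ← iQ2]; exact ind_snoc_mono hC p (by decide)
  have sQ12 : Q1 ⊆ Q2 := subset_of_ind_le nQ12
  have nQ02 : ∀ p, ind Q0 p ≤ ind Q2 p := fun p => by rw [← iQ0, ← iQ2]; exact ind_snoc_mono hC p (by decide)
  have sQ02 : Q0 ⊆ Q2 := subset_of_ind_le nQ02
  have nDU : ∀ p, ind D p ≤ ind (univ : Finset (Pd n)) p := fun p => by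
    unfold ind; rw [if_pos (Finset.mem_univ p)]; split_ifs <;> norm_num
  have sDU : D ⊆ (univ : Finset (Pd n)) := Finset.subset_univ D
  have eA : sStarD A B C =
      4 * 2 ^ n * (∑ p, ind D p * ind P0 p * ind Q0 p)
      - (∑ p, ∑ q, ind Q1 p * ind D q * ind P0 q * (if TotDist p q = true then (1:ℤ) else 0))
      - (∑ p, ∑ q, ind Q2 p * ind D q * ind P0 q * (if TotDist p q = true then (1:ℤ) else 0))
      - (∑ p, ∑ q, ind P1 p * ind D q * ind Q0 q * (if TotDist p q = true then (1:ℤ) else 0))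
      - (∑ p, ∑ q, ind D p * ind P1 q * ind Q1 q * (if TotDist p q = true then (1:ℤ) else 0))
      + (∑ q, ∑ r, ind P1 q * ind Q2 r * ind D (thirdPt q r) * (if TotDist q r = true then (1:ℤ) else 0))
      - (∑ p, ∑ q, ind P2 p * ind D q * ind Q0 q * (if TotDist p q = true then (1:ℤ) else 0))
      + (∑ q, ∑ r, ind P2 q * ind Q1 r * ind D (thirdPt q r) * (if TotDist q r = true then (1:ℤ) else 0))
      - (∑ p, ∑ q, ind D p * ind P2 q * ind Q2 q * (if TotDist p q = true then (1:ℤ) else 0))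
      - (∑ p, ∑ q, ind (univ : Finset (Pd n)) p * ind P0 q * ind Q0 q * (if TotDist p q = true then (1:ℤ) else 0))
      - (∑ p, ∑ q, ind P0 p * ind (univ : Finset (Pd n)) q * ind Q1 q * (if TotDist p q = true then (1:ℤ) else 0))
      + (∑ q, ∑ r, ind P0 q * ind Q2 r * ind (univ : Finset (Pd n)) (thirdPt q r) * (if TotDist q r = true then (1:ℤ) else 0))
      - (∑ p, ∑ q, ind Q0 p * ind (univ : Finset (Pd n)) q * ind P1 q * (if TotDist p q = true then (1:ℤ) else 0))
      + 4 * 2 ^ n * (∑ p, ind (univ : Finset (Pd n)) p * ind P1 p * ind Q1 p)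
      - (∑ p, ∑ q, ind Q2 p * ind (univ : Finset (Pd n)) q * ind P1 q * (if TotDist p q = true then (1:ℤ) else 0))
      + (∑ q, ∑ r, ind P2 q * ind Q0 r * ind (univ : Finset (Pd n)) (thirdPt q r) * (if TotDist q r = true then (1:ℤ) else 0))
      - (∑ p, ∑ q, ind P2 p * ind (univ : Finset (Pd n)) q * ind Q1 q * (if TotDist p q = true then (1:ℤ) else 0))
      - (∑ p, ∑ q, ind (univ : Finset (Pd n)) p * ind P2 q * ind Q2 q * (if TotDist p q = true then (1:ℤ) else 0))
      - (∑ p, ∑ q, ind (univ : Finset (Pd n)) p * ind P0 q * ind Q0 q * (if TotDist p q = true then (1:ℤ) else 0))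
      + (∑ q, ∑ r, ind P0 q * ind Q1 r * ind (univ : Finset (Pd n)) (thirdPt q r) * (if TotDist q r = true then (1:ℤ) else 0))
      - (∑ p, ∑ q, ind P0 p * ind (univ : Finset (Pd n)) q * ind Q2 q * (if TotDist p q = true then (1:ℤ) else 0))
      + (∑ q, ∑ r, ind P1 q * ind Q0 r * ind (univ : Finset (Pd n)) (thirdPt q r) * (if TotDist q r = true then (1:ℤ) else 0))
      - (∑ p, ∑ q, ind (univ : Finset (Pd n)) p * ind P1 q * ind Q1 q * (if TotDist p q = true then (1:ℤ) else 0))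
      - (∑ p, ∑ q, ind P1 p * ind (univ : Finset (Pd n)) q * ind Q2 q * (if TotDist p q = true then (1:ℤ) else 0))
      - (∑ p, ∑ q, ind Q0 p * ind (univ : Finset (Pd n)) q * ind P2 q * (if TotDist p q = true then (1:ℤ) else 0))
      - (∑ p, ∑ q, ind Q1 p * ind (univ : Finset (Pd n)) q * ind P2 q * (if TotDist p q = true then (1:ℤ) else 0))
      + 4 * 2 ^ n * (∑ p, ind (univ : Finset (Pd n)) p * ind P2 p * ind Q2 p) := by
    rw [sStarD_eq_sum_ind]
    simp only [sum_snoc, Fin.sum_univ_three, iA0, iA1, iA2, iP0, iP1, iP2, iQ0, iQ1, iQ2, Finset.sum_add_distrib]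
    rw [block_eq, block_eq, block_eq, block_eq, block_eq, block_eq, block_eq, block_eq, block_eq, block_eq, block_eq, block_eq, block_eq, block_eq, block_eq, block_eq, block_eq, block_eq, block_eq, block_eq, block_eq, block_eq, block_eq, block_eq, block_eq, block_eq, block_eq]
    obtain ⟨cv0, cv1, cv2, cv3, cv4, cv5, cv6, cv7, cv8, cv9, cv10, cv11, cv12, cv13, cv14, cv15, cv16, cv17, cv18, cv19, cv20, cv21, cv22, cv23, cv24, cv25, cv26, cv27, cv28, cv29, cv30, cv31, cv32, cv33, cv34, cv35, cv36, cv37, cv38, cv39, cv40⟩ := c_vals_all₁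
    obtain ⟨cw0, cw1, cw2, cw3, cw4, cw5, cw6, cw7, cw8, cw9, cw10, cw11, cw12, cw13, cw14, cw15, cw16, cw17, cw18, cw19, cw20, cw21, cw22, cw23, cw24, cw25, cw26, cw27, cw28, cw29, cw30, cw31, cw32, cw33, cw34, cw35, cw36, cw37, cw38, cw39⟩ := c_vals_all₂
    simp only [cv0, cv1, cv2, cv3, cv4, cv5, cv6, cv7, cv8, cv9, cv10, cv11, cv12, cv13, cv14, cv15, cv16, cv17, cv18, cv19, cv20, cv21, cv22, cv23, cv24, cv25, cv26, cv27, cv28, cv29, cv30, cv31, cv32, cv33, cv34, cv35, cv36, cv37, cv38, cv39, cv40, cw0, cw1, cw2, cw3, cw4, cw5, cw6, cw7, cw8, cw9, cw10, cw11, cw12, cw13, cw14, cw15, cw16, cw17, cw18, cw19, cw20, cw21, cw22, cw23, cw24, cw25, cw26, cw27, cw28, cw29, cw30, cw31, cw32, cw33, cw34, cw35, cw36, cw37, cw38, cw39]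
    ring
  have eS_U_P1_Q1 := sStarD_counting (univ : Finset (Pd n)) P1 Q1
  have eS_U_P2_Q2 := sStarD_counting (univ : Finset (Pd n)) P2 Q2
  have fS_P2_Q2 := sum_ind_totDist_le n P2 Q2 hP2up hQ2up
  have fhC001 := sum_ind3_totDist_le hQ1up hDup hP0up
  rw [reord1' Q1 D P0] at fhC001
  have fhC002 := sum_ind3_totDist_le hQ2up hDup hP0up
  rw [reord1' Q2 D P0] at fhC002
  have fhB010 := sum_ind3_totDist_le hP1up hDup hQ0up
  rw [reord1 P1 D Q0] at fhB010
  have fhB020 := sum_ind3_totDist_le hP2up hDup hQ0up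
  rw [reord1 P2 D Q0] at fhB020
  have fkA112 := sum_lat_le_td_first ((univ : Finset (Pd n)) \ D) hP1up hQ2up
  rw [sum2_ind_sdiff_third sDU, sum2_ind_sdiff_first sDU] at fkA112
  have fkA121 := sum_lat_le_td_first ((univ : Finset (Pd n)) \ D) hP2up hQ1up
  rw [sum2_ind_sdiff_third sDU, sum2_ind_sdiff_first sDU] at fkA121
  have fp0 : 0 ≤ 2 ^ n * ((∑ p, ind (univ : Finset (Pd n)) p * ind P1 p * ind Q0 p) - (∑ p, ind (univ : Finset (Pd n)) p * ind P0 p * ind Q0 p) - (∑ p, ind D p * ind P1 p * ind Q0 p) + (∑ p, ind D p * ind P0 p * ind Q0 p)) := by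
    refine mul_nonneg (pow_nonneg (by norm_num) n) ?_
    have e : (∑ p, (ind (univ : Finset (Pd n)) p - ind D p) * (ind P1 p - ind P0 p) * ind Q0 p) = ((∑ p, ind (univ : Finset (Pd n)) p * ind P1 p * ind Q0 p) - (∑ p, ind (univ : Finset (Pd n)) p * ind P0 p * ind Q0 p) - (∑ p, ind D p * ind P1 p * ind Q0 p) + (∑ p, ind D p * ind P0 p * ind Q0 p)) := by
      simp only [sub_mul, mul_sub, Finset.sum_sub_distrib]; ring
    rw [← e]
    exact Finset.sum_nonneg fun p _ => mul_nonneg (mul_nonneg (by linarith [nDU p]) (by linarith [nP01 p])) (ind_nonneg' _ p)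
  have fp1 : 0 ≤ 2 ^ n * ((∑ p, ind (univ : Finset (Pd n)) p * ind P2 p * ind Q2 p) - (∑ p, ind (univ : Finset (Pd n)) p * ind P0 p * ind Q2 p) - (∑ p, ind D p * ind P2 p * ind Q2 p) + (∑ p, ind D p * ind P0 p * ind Q2 p)) := by
    refine mul_nonneg (pow_nonneg (by norm_num) n) ?_
    have e : (∑ p, (ind (univ : Finset (Pd n)) p - ind D p) * (ind P2 p - ind P0 p) * ind Q2 p) = ((∑ p, ind (univ : Finset (Pd n)) p * ind P2 p * ind Q2 p) - (∑ p, ind (univ : Finset (Pd n)) p * ind P0 p * ind Q2 p) - (∑ p, ind D p * ind P2 p * ind Q2 p) + (∑ p, ind D p * ind P0 p * ind Q2 p)) := by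
      simp only [sub_mul, mul_sub, Finset.sum_sub_distrib]; ring
    rw [← e]
    exact Finset.sum_nonneg fun p _ => mul_nonneg (mul_nonneg (by linarith [nDU p]) (by linarith [nP02 p])) (ind_nonneg' _ p)
  have fp2 : 0 ≤ 2 ^ n * ((∑ p, ind (univ : Finset (Pd n)) p * ind P0 p * ind Q1 p) - (∑ p, ind (univ : Finset (Pd n)) p * ind P0 p * ind Q0 p) - (∑ p, ind D p * ind P0 p * ind Q1 p) + (∑ p, ind D p * ind P0 p * ind Q0 p)) := by
    refine mul_nonneg (pow_nonneg (by norm_num) n) ?_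
    have e : (∑ p, (ind (univ : Finset (Pd n)) p - ind D p) * ind P0 p * (ind Q1 p - ind Q0 p)) = ((∑ p, ind (univ : Finset (Pd n)) p * ind P0 p * ind Q1 p) - (∑ p, ind (univ : Finset (Pd n)) p * ind P0 p * ind Q0 p) - (∑ p, ind D p * ind P0 p * ind Q1 p) + (∑ p, ind D p * ind P0 p * ind Q0 p)) := by
      simp only [sub_mul, mul_sub, Finset.sum_sub_distrib]; ring
    rw [← e]
    exact Finset.sum_nonneg fun p _ => mul_nonneg (mul_nonneg (by linarith [nDU p]) (ind_nonneg' _ p)) (by linarith [nQ01 p])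
  have fp3 : 0 ≤ 2 ^ n * ((∑ p, ind (univ : Finset (Pd n)) p * ind P0 p * ind Q2 p) - (∑ p, ind (univ : Finset (Pd n)) p * ind P0 p * ind Q0 p) - (∑ p, ind D p * ind P0 p * ind Q2 p) + (∑ p, ind D p * ind P0 p * ind Q0 p)) := by
    refine mul_nonneg (pow_nonneg (by norm_num) n) ?_
    have e : (∑ p, (ind (univ : Finset (Pd n)) p - ind D p) * ind P0 p * (ind Q2 p - ind Q0 p)) = ((∑ p, ind (univ : Finset (Pd n)) p * ind P0 p * ind Q2 p) - (∑ p, ind (univ : Finset (Pd n)) p * ind P0 p * ind Q0 p) - (∑ p, ind D p * ind P0 p * ind Q2 p) + (∑ p, ind D p * ind P0 p * ind Q0 p)) := by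
      simp only [sub_mul, mul_sub, Finset.sum_sub_distrib]; ring
    rw [← e]
    exact Finset.sum_nonneg fun p _ => mul_nonneg (mul_nonneg (by linarith [nDU p]) (ind_nonneg' _ p)) (by linarith [nQ02 p])
  have fp4 : 0 ≤ 2 ^ n * ((∑ p, ind (univ : Finset (Pd n)) p * ind P1 p * ind Q1 p) - (∑ p, ind (univ : Finset (Pd n)) p * ind P1 p * ind Q0 p) - (∑ p, ind (univ : Finset (Pd n)) p * ind P0 p * ind Q1 p) + (∑ p, ind (univ : Finset (Pd n)) p * ind P0 p * ind Q0 p)) := by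
    refine mul_nonneg (pow_nonneg (by norm_num) n) ?_
    have e : (∑ p, ind (univ : Finset (Pd n)) p * (ind P1 p - ind P0 p) * (ind Q1 p - ind Q0 p)) = ((∑ p, ind (univ : Finset (Pd n)) p * ind P1 p * ind Q1 p) - (∑ p, ind (univ : Finset (Pd n)) p * ind P1 p * ind Q0 p) - (∑ p, ind (univ : Finset (Pd n)) p * ind P0 p * ind Q1 p) + (∑ p, ind (univ : Finset (Pd n)) p * ind P0 p * ind Q0 p)) := by
      simp only [sub_mul, mul_sub, Finset.sum_sub_distrib]; ring
    rw [← e]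
    exact Finset.sum_nonneg fun p _ => mul_nonneg (mul_nonneg (ind_nonneg' _ p) (by linarith [nP01 p])) (by linarith [nQ01 p])
  have fp5 : 0 ≤ 2 ^ n * ((∑ p, ind D p * ind P2 p * ind Q2 p) - (∑ p, ind D p * ind P2 p * ind Q0 p) - (∑ p, ind D p * ind P0 p * ind Q2 p) + (∑ p, ind D p * ind P0 p * ind Q0 p)) := by
    refine mul_nonneg (pow_nonneg (by norm_num) n) ?_
    have e : (∑ p, ind D p * (ind P2 p - ind P0 p) * (ind Q2 p - ind Q0 p)) = ((∑ p, ind D p * ind P2 p * ind Q2 p) - (∑ p, ind D p * ind P2 p * ind Q0 p) - (∑ p, ind D p * ind P0 p * ind Q2 p) + (∑ p, ind D p * ind P0 p * ind Q0 p)) := by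
      simp only [sub_mul, mul_sub, Finset.sum_sub_distrib]; ring
    rw [← e]
    exact Finset.sum_nonneg fun p _ => mul_nonneg (mul_nonneg (ind_nonneg' _ p) (by linarith [nP02 p])) (by linarith [nQ02 p])
  have fp6 : 0 ≤ (∑ p, ∑ q, ind Q2 p * ind (univ : Finset (Pd n)) q * ind P2 q * (if TotDist p q = true then (1:ℤ) else 0)) - (∑ p, ∑ q, ind Q1 p * ind (univ : Finset (Pd n)) q * ind P2 q * (if TotDist p q = true then (1:ℤ) else 0)) - (∑ p, ∑ q, ind Q2 p * ind (univ : Finset (Pd n)) q * ind P1 q * (if TotDist p q = true then (1:ℤ) else 0)) + (∑ p, ∑ q, ind Q1 p * ind (univ : Finset (Pd n)) q * ind P1 q * (if TotDist p q = true then (1:ℤ) else 0)) := by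
    have e : (∑ p, ∑ q, (ind Q2 p - ind Q1 p) * ind (univ : Finset (Pd n)) q * (ind P2 q - ind P1 q) * (if TotDist p q = true then (1:ℤ) else 0)) = ((∑ p, ∑ q, ind Q2 p * ind (univ : Finset (Pd n)) q * ind P2 q * (if TotDist p q = true then (1:ℤ) else 0)) - (∑ p, ∑ q, ind Q1 p * ind (univ : Finset (Pd n)) q * ind P2 q * (if TotDist p q = true then (1:ℤ) else 0)) - (∑ p, ∑ q, ind Q2 p * ind (univ : Finset (Pd n)) q * ind P1 q * (if TotDist p q = true then (1:ℤ) else 0)) + (∑ p, ∑ q, ind Q1 p * ind (univ : Finset (Pd n)) q * ind P1 q * (if TotDist p q = true then (1:ℤ) else 0))) := by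
      simp only [sub_mul, mul_sub, Finset.sum_sub_distrib]; ring
    rw [← e]
    exact Finset.sum_nonneg fun p _ => Finset.sum_nonneg fun q _ =>
      mul_nonneg (mul_nonneg (mul_nonneg (by linarith [nQ12 p]) (ind_nonneg' _ q)) (by linarith [nP12 q])) (by split_ifs <;> norm_num)
  have fp7 : 0 ≤ (∑ p, ∑ q, ind (univ : Finset (Pd n)) p * ind P2 q * ind Q2 q * (if TotDist p q = true then (1:ℤ) else 0)) - (∑ p, ∑ q, ind (univ : Finset (Pd n)) p * ind P2 q * ind Q1 q * (if TotDist p q = true then (1:ℤ) else 0)) - (∑ p, ∑ q, ind (univ : Finset (Pd n)) p * ind P1 q * ind Q2 q * (if TotDist p q = true then (1:ℤ) else 0)) + (∑ p, ∑ q, ind (univ : Finset (Pd n)) p * ind P1 q * ind Q1 q * (if TotDist p q = true then (1:ℤ) else 0)) - (∑ p, ∑ q, ind D p * ind P2 q * ind Q2 q * (if TotDist p q = true then (1:ℤ) else 0)) + (∑ p, ∑ q, ind D p * ind P2 q * ind Q1 q * (if TotDist p q = true then (1:ℤ) else 0)) + (∑ p, ∑ q, ind D p * ind P1 q * ind Q2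 q * (if TotDist p q = true then (1:ℤ) else 0)) - (∑ p, ∑ q, ind D p * ind P1 q * ind Q1 q * (if TotDist p q = true then (1:ℤ) else 0)) := by
    have e : (∑ p, ∑ q, (ind (univ : Finset (Pd n)) p - ind D p) * (ind P2 q - ind P1 q) * (ind Q2 q - ind Q1 q) * (if TotDist p q = true then (1:ℤ) else 0)) = ((∑ p, ∑ q, ind (univ : Finset (Pd n)) p * ind P2 q * ind Q2 q * (if TotDist p q = true then (1:ℤ) else 0)) - (∑ p, ∑ q, ind (univ : Finset (Pd n)) p * ind P2 q * ind Q1 q * (if TotDist p q = true then (1:ℤ) else 0)) - (∑ p, ∑ q, ind (univ : Finset (Pd n)) p * ind P1 q * ind Q2 q * (if TotDist p q = true then (1:ℤ) else 0)) + (∑ p, ∑ q, ind (univ : Finset (Pd n)) p * ind P1 q * ind Q1 q * (if TotDist p q = true then (1:ℤ) else 0)) - (∑ p, ∑ q, ind D p * ind P2 q * ind Q2 q * (if TotDist p q = true then (1:ℤ) else 0)) + (∑ p, ∑ q, ind D p * ind P2 q * ind Q1 q * (if TotDist p q = true then (1:ℤ) else 0)) + (∑ p, ∑ q, ind D p * ind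 P1 q * ind Q2 q * (if TotDist p q = true then (1:ℤ) else 0)) - (∑ p, ∑ q, ind D p * ind P1 q * ind Q1 q * (if TotDist p q = true then (1:ℤ) else 0))) := by
      simp only [sub_mul, mul_sub, Finset.sum_sub_distrib]; ring
    rw [← e]
    exact Finset.sum_nonneg fun p _ => Finset.sum_nonneg fun q _ =>
      mul_nonneg (mul_nonneg (mul_nonneg (by linarith [nDU p]) (by linarith [nP12 q])) (by linarith [nQ12 q])) (by split_ifs <;> norm_num)
  have uT00 : 2 ^ n * (∑ p, ind (univ : Finset (Pd n)) p * ind P0 p * ind Q0 p) = 2 ^ n * (∑ p, ind P0 p * ind Q0 p) := by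
    rw [normT]
  have uNA00 := normNA P0 Q0
  have uNB00 := normNB P0 Q0
  have uNC00 := normNC P0 Q0
  have uL00 := normL P0 Q0
  have uT01 : 2 ^ n * (∑ p, ind (univ : Finset (Pd n)) p * ind P0 p * ind Q1 p) = 2 ^ n * (∑ p, ind P0 p * ind Q1 p) := by
    rw [normT]
  have uNA01 := normNA P0 Q1
  have uNB01 := normNB P0 Q1
  have uNC01 := normNC P0 Q1
  have uL01 := normL P0 Q1
  have uT02 : 2 ^ n * (∑ p, ind (univ : Finset (Pd n)) p * ind P0 p * ind Q2 p) = 2 ^ n * (∑ p, ind P0 p * ind Q2 p) := by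
    rw [normT]
  have uNA02 := normNA P0 Q2
  have uNB02 := normNB P0 Q2
  have uNC02 := normNC P0 Q2
  have uL02 := normL P0 Q2
  have uT10 : 2 ^ n * (∑ p, ind (univ : Finset (Pd n)) p * ind P1 p * ind Q0 p) = 2 ^ n * (∑ p, ind P1 p * ind Q0 p) := by
    rw [normT]
  have uNA10 := normNA P1 Q0
  have uNB10 := normNB P1 Q0
  have uNC10 := normNC P1 Q0
  have uL10 := normL P1 Q0
  have uT11 : 2 ^ n * (∑ p, ind (univ : Finset (Pd n)) p * ind P1 p * ind Q1 p) = 2 ^ n * (∑ p, ind P1 p * ind Q1 p) := by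
    rw [normT]
  have uNA11 := normNA P1 Q1
  have uNB11 := normNB P1 Q1
  have uNC11 := normNC P1 Q1
  have uL11 := normL P1 Q1
  have uT12 : 2 ^ n * (∑ p, ind (univ : Finset (Pd n)) p * ind P1 p * ind Q2 p) = 2 ^ n * (∑ p, ind P1 p * ind Q2 p) := by
    rw [normT]
  have uNA12 := normNA P1 Q2
  have uNB12 := normNB P1 Q2
  have uNC12 := normNC P1 Q2
  have uL12 := normL P1 Q2
  have uT20 : 2 ^ n * (∑ p, ind (univ : Finset (Pd n)) p * ind P2 p * ind Q0 p) = 2 ^ n * (∑ p, ind P2 p * ind Q0 p) := by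
    rw [normT]
  have uNA20 := normNA P2 Q0
  have uNB20 := normNB P2 Q0
  have uNC20 := normNC P2 Q0
  have uL20 := normL P2 Q0
  have uT21 : 2 ^ n * (∑ p, ind (univ : Finset (Pd n)) p * ind P2 p * ind Q1 p) = 2 ^ n * (∑ p, ind P2 p * ind Q1 p) := by
    rw [normT]
  have uNA21 := normNA P2 Q1
  have uNB21 := normNB P2 Q1
  have uNC21 := normNC P2 Q1
  have uL21 := normL P2 Q1
  have uT22 : 2 ^ n * (∑ p, ind (univ : Finset (Pd n)) p * ind P2 p * ind Q2 p) = 2 ^ n * (∑ p, ind P2 p * ind Q2 p) := by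
    rw [normT]
  have uNA22 := normNA P2 Q2
  have uNB22 := normNB P2 Q2
  have uNC22 := normNC P2 Q2
  have uL22 := normL P2 Q2
  rw [eS_U_P1_Q1, eS_U_P2_Q2, eA]
  linarith [fS_P2_Q2, fhC001, fhC002, fhB010, fhB020, fkA112, fkA121, fp0, fp1, fp2, fp3, fp4, fp5, fp6, fp7, uT00, uNA00, uNB00, uNC00, uL00, uT01, uNA01, uNB01, uNC01, uL01, uT02, uNA02, uNB02, uNC02, uL02, uT10, uNA10, uNB10, uNC10, uL10, uT11, uNA11, uNB11, uNC11, uL11, uT12, uNA12, uNB12, uNC12, uL12, uT20, uNA20, uNB20, uNC20, uL20, uT21, uNA21, uNB21, uNC21, uL21, uT22, uNA22, uNB22, uNC22, uL22]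

end Summit.CriticalPhenomena.PercolationContinuityZ3.Theorems.SahiGridPattern
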